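import Literature.AlgebraicGeometry.Hu2025.Statements.S01S09Interface.R110cUniversalityInterface
import Literature.AlgebraicGeometry.Hu2025.Proofs.S01S09Interface.Prop91Ours
import Literature.AlgebraicGeometry.Hu2025.Proofs.S03Pluecker.GammaQuadPlane
import HarnessLib

/-!
# Hu 2025 — the complete quadrilateral as a REALISABLE rank-3 family on `[9]` in the vocabulary of row 110c (`HuMatroid`,
# `InStratum`, `IsRealisable`, `VertexMem`, `PlueckerNonzero`): `Γ_quad = {456, 478, 579, 689}` is exactly the set of 3-subsets `u`
# with `x_u ∉ Δ^{3,9}_d` (joint J1 / GAP-LEDGER-HU row HU-R01 — kernel support, OURS)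

**HONEST FRAMING (D-0012/D-0089).** [Hu2025] is an unrefereed preprint under adjudication; nothing of it is asserted. Row 110c types
[Hu25] §9 / Prop. 9.1 at field-valued points: a family `d = (d_I)` (`HuMatroid n 3`), its matroid Schubert cell (`InStratum`), the
occurrence of the stratum (`HuMatroid.IsRealisable`), and «`x_u ∈ Δ^{d,n}_d`» combinatorially (`VertexMem`). This file instantiates
them at the configuration of `Proofs/S03Pluecker/GammaQuadPlane.lean`: `quadHuMatroid` has `d_I := dim_ℚ (quadPlane ∩ E_I)` (a
REALISED family, so it occurs: `isRealisable_quadHuMatroid`, with `quadPlane` in its stratum), and for every `u ∈ 𝕀_{3,9}`,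
**`VertexMem quadHuMatroid u ↔ u ∉ Γ_quad`** (`vertexMem_quadHuMatroid_iff`) — so the typed Γ-scheme of rows 101/109 for
`Γ = Γ_quad`, which `Proofs/S03Pluecker/GammaQuadNotIntegral.lean` shows is NOT integral, is the Γ-scheme `Z_{Γ_d}` of the set
`Γ_d = {x_u : x_u ∉ Δ_d}` (Prop. 9.1, C72L71) of an OCCURRING stratum `d`. What is NOT typed here: the torus quotient
`X = Gr^{3,E}_d/(𝔾⁹_m/𝔾_m)` (row 110c's abstract `LafforgueObjects.barGr`) and its integrality — the antecedent «X integral» of the J1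
inference ([Hu22] p.131 l.40–41) is discussed in prose in the HU-R01 evidence note. AI proof is weaker than expert review.
-/

noncomputable section

namespace Literature.AlgebraicGeometry.Hu2025.Statements.S01S09Interface

open S03Pluecker Prop9_1Ours

/-- **The realised rank-3 family on `[9]` of the complete-quadrilateral configuration**: `d_I := dim_ℚ (quadPlane ∩ E_I)` — the
family of the stratum through the `ℚ`-point `quadPlane` (a `HuMatroid 9 3` by `Prop9_1Ours.isCorank_corank`). OURS.
[cite: Hu2025, §9 «matroid of rank d on the set [n]» (chunk p0072 l.26–34; PDF p.159) and Prop. 9.1 (p.160); joint J1 = GAP-LEDGER-HU row HU-R01 (unrefereed preprint arXiv:2507.21400v1 under adjudication, D-0012/D-0089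
— kernel support on OUR typed carriers of rows 101/110; nothing of the source asserted)] -/
def quadHuMatroid : HuMatroid 9 3 where
  dI := corank quadPlane
  dI_empty := (isCorank_corank quadPlane finrank_quadPlane).empty
  dI_univ := (isCorank_corank quadPlane finrank_quadPlane).univ
  dI_supermod := (isCorank_corank quadPlane finrank_quadPlane).supermod

/-- `quadPlane` lies in the stratum of `quadHuMatroid` (by construction).
[cite: Hu2025, §9 «Gr^{3,E}_d» (chunk p0072 l.22–24; PDF p.159); joint J1 = GAP-LEDGER-HU row HU-R01 (unrefereed preprint arXiv:2507.21400v1 under adjudication, D-0012/D-0089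
— kernel support on OUR typed carriers of rows 101/110; nothing of the source asserted)] -/
theorem inStratum_quadPlane : InStratum ℚ quadHuMatroid quadPlane :=
  ⟨finrank_quadPlane, fun _ => rfl⟩

/-- **The stratum of `quadHuMatroid` OCCURS** (`HuMatroid.IsRealisable`, witnessed over `ℚ` by `quadPlane`).
[cite: Hu2025, §9 (chunk p0072 l.24–28; PDF p.159); joint J1 = GAP-LEDGER-HU row HU-R01 (unrefereed preprint arXiv:2507.21400v1 under adjudication, D-0012/D-0089
— kernel support on OUR typed carriers of rows 101/110; nothing of the source asserted)] -/
theorem isRealisable_quadHuMatroid : quadHuMatroid.IsRealisable :=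
  ⟨ℚ, inferInstance, quadPlane, inStratum_quadPlane⟩

/-! ## The 3-subset `tripleSet 9 u` of an index `u ∈ 𝕀_{3,9}` and the column selection `colSel u` -/

/-- `colSel u j ∈ tripleSet 9 u`.
[cite: Hu2025, Prop. 9.1 (p.160); joint J1 = GAP-LEDGER-HU row HU-R01 (unrefereed preprint arXiv:2507.21400v1 under adjudication, D-0012/D-0089
— kernel support on OUR typed carriers of rows 101/110; nothing of the source asserted)] -/
theorem colSel_mem_tripleSet {u : ℕ × ℕ × ℕ} (hu : u ∈ plIndexSet 9) (j : Fin 3) : colSel u j ∈ tripleSet 9 u := by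
  have hidx := mem_plIndexSet_iff.mp hu
  have h1 : (u.1 - 1) % 9 + 1 = u.1 := by omega
  have h2 : (u.2.1 - 1) % 9 + 1 = u.2.1 := by omega
  have h3 : (u.2.2 - 1) % 9 + 1 = u.2.2 := by omega
  fin_cases j <;> simp [colSel, tripleSet, h1, h2, h3]

/-- `colSel u` is injective for `u ∈ 𝕀_{3,9}` (the entries of `u` are distinct).
[cite: Hu2025, Prop. 9.1 (p.160); joint J1 = GAP-LEDGER-HU row HU-R01 (unrefereed preprint arXiv:2507.21400v1 under adjudication, D-0012/D-0089
— kernel support on OUR typed carriers of rows 101/110; nothing of the source asserted)] -/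
theorem colSel_injective {u : ℕ × ℕ × ℕ} (hu : u ∈ plIndexSet 9) : Function.Injective (colSel u) := by
  have hidx := mem_plIndexSet_iff.mp hu
  intro i j h
  have hv := congrArg Fin.val h
  fin_cases i <;> fin_cases j <;> simp [colSel] at hv ⊢ <;> omega

/-- `tripleSet 9 u` is the image of `colSel u`.
[cite: Hu2025, Prop. 9.1 (p.160); joint J1 = GAP-LEDGER-HU row HU-R01 (unrefereed preprint arXiv:2507.21400v1 under adjudication, D-0012/D-0089
— kernel support on OUR typed carriers of rows 101/110; nothing of the source asserted)] -/
theorem tripleSet_eq_image_colSel {u : ℕ × ℕ × ℕ} (hu : u ∈ plIndexSet 9) :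
    tripleSet 9 u = Finset.univ.image (colSel u) := by
  have hidx := mem_plIndexSet_iff.mp hu
  ext i
  constructor
  · intro hi
    simp only [tripleSet, Finset.mem_filter, Finset.mem_univ, true_and, Finset.mem_insert,
      Finset.mem_singleton] at hi
    rw [Finset.mem_image]
    rcases hi with hi | hi | hi
    · refine ⟨0, Finset.mem_univ _, Fin.ext ?_⟩
      simp [colSel]; omega
    · refine ⟨1, Finset.mem_univ _, Fin.ext ?_⟩
      simp [colSel]; omega
    · refine ⟨2, Finset.mem_univ _, Fin.ext ?_⟩
      simp [colSel]; omega
  · intro hi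
    rw [Finset.mem_image] at hi
    obtain ⟨j, -, rfl⟩ := hi
    exact colSel_mem_tripleSet hu j

/-- `|tripleSet 9 u| = 3` for `u ∈ 𝕀_{3,9}`.
[cite: Hu2025, Prop. 9.1 (p.160); joint J1 = GAP-LEDGER-HU row HU-R01 (unrefereed preprint arXiv:2507.21400v1 under adjudication, D-0012/D-0089
— kernel support on OUR typed carriers of rows 101/110; nothing of the source asserted)] -/
theorem card_tripleSet {u : ℕ × ℕ × ℕ} (hu : u ∈ plIndexSet 9) : (tripleSet 9 u).card = 3 := by
  rw [tripleSet_eq_image_colSel hu, Finset.card_image_of_injective _ (colSel_injective hu), Finset.card_univ,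
    Fintype.card_fin]

/-- The column selection as an equivalence `Fin 3 ≃ tripleSet 9 u`.
[cite: Hu2025, Prop. 9.1 (p.160); joint J1 = GAP-LEDGER-HU row HU-R01 (unrefereed preprint arXiv:2507.21400v1 under adjudication, D-0012/D-0089
— kernel support on OUR typed carriers of rows 101/110; nothing of the source asserted)] -/
def colSelEquiv {u : ℕ × ℕ × ℕ} (hu : u ∈ plIndexSet 9) : Fin 3 ≃ ↥(tripleSet 9 u) :=
  Equiv.ofBijective (fun j => ⟨colSel u j, colSel_mem_tripleSet hu j⟩)
    ⟨fun i j h => colSel_injective hu (congrArg Subtype.val h), fun ⟨i, hi⟩ => by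
      rw [tripleSet_eq_image_colSel hu, Finset.mem_image] at hi
      obtain ⟨j, -, rfl⟩ := hi
      exact ⟨j, rfl⟩⟩

/-! ## Plücker non-vanishing and `VertexMem` at the configuration -/

/-- **`p_u(quadPlane) ≠ 0 ↔ u ∉ Γ_quad`** (row 110c's `PlueckerNonzero`, via the determinant criterion of `GammaQuadPlane`).
[cite: Hu2025, Prop. 9.1 «p_i ≠ 0, ∀ x_i ∈ Δ_d» (chunk p0072 l.77–80; PDF p.160); joint J1 = GAP-LEDGER-HU row HU-R01 (unrefereed preprint arXiv:2507.21400v1 under adjudication, D-0012/D-0089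
— kernel support on OUR typed carriers of rows 101/110; nothing of the source asserted)] -/
theorem plueckerNonzero_quadPlane_iff {u : ℕ × ℕ × ℕ} (hu : u ∈ plIndexSet 9) :
    PlueckerNonzero ℚ quadPlane (tripleSet 9 u) ↔ u ∉ quadGamma := by
  have h := bijective_restrict_rowSpan_iff quadMatrix quadMatrix_vecMul_injective (tripleSet 9 u) (colSelEquiv hu)
  have hcols : (fun j : Fin 3 => ((colSelEquiv hu j : ↥(tripleSet 9 u)) : Fin 9)) = colSel u := rfl
  rw [hcols, Matrix.isUnit_iff_isUnit_det, isUnit_iff_ne_zero, det_quadMatrix_submatrix_ne_zero_iff hu] at h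
  exact h

/-- **`x_u ∈ Δ^{3,9}_d ↔ u ∉ Γ_quad`** for the realised family `d = quadHuMatroid` and every `u ∈ 𝕀_{3,9}` (row 110c's
`VertexMem`; through `prop9_1_of_isRealisable` — Prop. 9.1 holds for occurring strata — and `plueckerNonzero_quadPlane_iff`). Hence
`Γ_d ∩ {chart variables} = Γ_quad`: the Γ of the J1 kernel files IS a `Γ_d` (Prop. 9.1, C72L71) of an occurring stratum.
[cite: Hu2025, Prop. 9.1 (chunk p0072 l.71–80; PDF p.160), Γ := Γ_d (C72L71); joint J1 = GAP-LEDGER-HU row HU-R01 (unrefereed preprint arXiv:2507.21400v1 under adjudication, D-0012/D-0089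
— kernel support on OUR typed carriers of rows 101/110; nothing of the source asserted)] -/
theorem vertexMem_quadHuMatroid_iff {u : ℕ × ℕ × ℕ} (hu : u ∈ plIndexSet 9) :
    VertexMem quadHuMatroid (tripleSet 9 u) ↔ u ∉ quadGamma := by
  have hP := prop9_1_of_isRealisable quadHuMatroid isRealisable_quadHuMatroid ℚ quadPlane finrank_quadPlane
  rw [← (hP.mp inStratum_quadPlane) (tripleSet 9 u) (card_tripleSet hu)]
  exact plueckerNonzero_quadPlane_iff hu

/-- **The frame is a vertex**: `x_{123} ∈ Δ_d` (`m = (1,2,3) ∉ Γ_quad`), so the chart `𝕌 = (p_m ≠ 0)` of rows 101/109 is the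
chart «p_m ≡ 1» of C72L129–130 for this `d`.
[cite: Hu2025, §9 «there exists m such that x_m ∈ Δ_d» (chunk p0072 l.128–130; PDF p.161); joint J1 = GAP-LEDGER-HU row HU-R01 (unrefereed preprint arXiv:2507.21400v1 under adjudication, D-0012/D-0089
— kernel support on OUR typed carriers of rows 101/110; nothing of the source asserted)] -/
theorem vertexMem_quadHuMatroid_mTri : VertexMem quadHuMatroid (tripleSet 9 mTri) := by
  rw [vertexMem_quadHuMatroid_iff (by decide)]
  simp [quadGamma, mTri]

end Literature.AlgebraicGeometry.Hu2025.Statements.S01S09Interface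

end
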